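import Literature.MathematicalPhysics.QuantumFieldTheory.O2OPEScanBridge
import Literature.MathematicalPhysics.QuantumFieldTheory.O2DimBox
import HarnessLib

/-!
# O(2) `{φ, s, t}` scan: enclosing the external forms `Q_k = α_k(V⃗_ext)` from node tables

[cite: ChesterEtAl2020, §3.2 (`V⃗_ext` defined implicitly; weaker condition), §3.3 (Algorithm 1:
`Q_i = α_i(V⃗_ext)`; scanning over external dimensions)]
[cite: Moore1979, §2.2 eqs. (2.14), (2.15), (2.19) (interval sum, difference, product), §2.4 (rounded interval arithmetic)]
[cite: KosPolandSimmonsduffin2014, §3.1 eq. (3.8) (cross-ratios `u = z z̄`, `v = (1−z)(1−z̄)`)]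

WHAT THIS FILE DOES (engines lane SDP-4, O(2) client path; Lean side only).  The robust OPE-scan
certificate of `O2OPEScanBridge` (`boxExcluded_of_coverTrees`, `boxExcluded_of_uniformCoverTrees`, and the
schemas built on them) carries the hypothesis
`henc : ∀ D ∈ Q, ∀ k, ExtEnclosed (F k).toFunctional D (Blo k) (Bhi k)` — entrywise enclosures
`Blo k ≤ α_k(V⃗_ext(D)) ≤ Bhi k` of the `4 × 4` external forms, valid for EVERY genuine choice of the three
external block families (exchanged `s` in `0⁺` at `(Δ_s, 0)`, exchanged `φ` in charge `1` at `(Δ_φ, 0)`,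
exchanged `t` in `2⁺` at `(Δ_t, 0)`).  No rule of the tree concludes `ExtEnclosed`; this file supplies the
rules a certificate reader discharges it with, from finitely many numbers:
* §1 ENTRIES AS NODE SUMS: for a scan functional, `α(V⃗)_{ik} = Σ_m Σ_r w_{m r} V⃗_r(u_m, v_m)_{ik}`
  (`alphaMat_toFunctional_apply`);
* §2 NODE TABLES ⇒ ENTRY ENCLOSURES: if every component value `V⃗_r(u_m, v_m)_{ik}` lies in
  `[Lo_{m r ik}, Hi_{m r ik}]` then `α(V⃗)_{ik} ∈ [Σ min(w·Lo, w·Hi), Σ max(w·Lo, w·Hi)]`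
  (`nodeEncLo`, `nodeEncHi`, `alphaMat_toFunctional_inBounds`) — plain interval arithmetic, the weights of
  either sign;
* §3 ASSEMBLY OF `V⃗_ext`: `α(V⃗_ext) = extForm (α(V⃗_{0⁺,Δ_s,0}[g_s])) (α(V⃗_{1,Δ_φ,0}[g_φ])) (α(V⃗_{2⁺,Δ_t,0}[g_t]))`
  (`alphaMat_Vext`, linearity over the printed index bookkeeping) and `extForm` is entrywise monotone
  (`inBounds_extForm`), so three channel enclosures valid for all genuine families give `ExtEnclosed`
  (`extEnclosed_of_channelBounds`); outward rounding (`extEnclosed_mono`);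
* §4 THE READER'S RULE AT ONE `D`: three node tables, one per channel, each valid for every genuine
  family of that channel (`NodeTable`) ⇒ `ExtEnclosed` with the explicit bounds of §2–§3
  (`extEnclosed_of_nodeTables`), and with any entrywise weaker rational bounds
  (`extEnclosed_of_nodeTables_of_le`);
* §5 COMPONENTS FROM BLOCK VALUES: every non-zero component of the printed crossing vectors is a
  multiple of `F^{ij,kl}_{∓}[g](u,v) = v^x g_L(u,v) ∓ u^x g_L(v,u)`; two-sided enclosures of `F_∓` from
  enclosures of the two block values and of the two powers (`powMul_mem_endpoints`, `Fm_mem_Icc`,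
  `Fp_mem_Icc`), and the power enclosure on a box of exponents (`rpow_mem_Icc_of_expo`, base in `(0,1)`;
  the nodes' cross-ratios lie in `(0,1)`: `u_mem_Ioo`, `v_mem_Ioo`);
* §5b THE PRINTED ROWS DECODED: every component of `V⃗_{0⁺}`, `V⃗_{1,·,0}` (`ε = 1`), `V⃗_{2⁺}` is
  `c⁻_{r,ik} F_−[g_{L_r}] + c⁺_{r,ik} F_+[g_{L_r}]` for ONE label `L_r` of the channel (`rowLab0p`, `coefM0p`,
  `coefP0p`, `V0p_apply_eq`, `rowLab0p_mem`; `rowLab1`, `coefM1`, `coefP1`, `V1_one_apply_eq`, `rowLab1_mem`;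
  `rowLab2p`, `coefM2p`, `coefP2p`, `V2p_apply_eq`, `rowLab2p_mem`), so an `F`-TABLE of a channel
  (enclosures of `F_∓[g_L](u_m, v_m)` for every `L` of the channel and node `m`, valid for every genuine
  family: `FTable`) yields its node table (`compLo`, `compHi`, `decoded_mem_Icc`,
  `nodeTable0p_of_FTable`, `nodeTable1_of_FTable`, `nodeTable2p_of_FTable`) and the three `F`-tables give
  `ExtEnclosed` (`extEnclosed_of_FTables`) — the reader's arithmetic is thereby fixed down to the block
  values;
* §6 UNIFORM ON A BOX OF EXTERNAL DIMENSIONS: node tables valid at every `D` of the box `[lo k, hi k]`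
  and bounds `Blo k, Bhi k` entrywise outside the assembled enclosure give LITERALLY the binder `henc` of
  `boxExcluded_of_uniformCoverTrees` / `O2PointSchema` / `O2DimBoxSchema` (`henc_of_nodeTables`), and
  the box-exclusion corollary over `boxExcluded_of_uniformCoverTrees` (`boxExcluded_of_nodeTables`).

HONEST SCOPE.  (i) The node tables are HYPOTHESES about the genuine blocks `g^{Δ_ij(L),Δ_kl(L)}_{Δ,0}` at the
`2M` points `(u_m, v_m)`, `(v_m, u_m)` (and, on a box, uniformly in `D`): certifying them is the block
enclosure layer (radial/`z`-series heads and tails), not this file.  (ii) Nothing here produces functionals,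
tables or trees, and no number of the paper is used: every number is an input a client cell's verifier
supplies and certifies.  honest framing: shared numerical engines serving client cells; rigour lives in
the verifiers; every published number belongs to a client cell's ledger, not to the engines group.

DECLARATIONS.  This file declares definitions (`nodeEncLo`, `nodeEncHi`, `NodeTable`, `rowLab0p`, `coefM0p`,
`coefP0p`, `rowLab1`, `coefM1`, `coefP1`, `rowLab2p`, `coefM2p`, `coefP2p`, `FTable`, `compLo`, `compHi`) and
theorems about them; it is filed as kind `definition`.

Sources.  S. M. Chester, W. Landry, J. Liu, D. Poland, D. Simmons-Duffin, N. Su, A. Vichi, *Carving out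
OPE space and precise O(2) model critical exponents*, JHEP 06 (2020) 142 [arXiv:1912.03324], §3.2 (the
external vector `V⃗_ext` and the weaker condition), §3.3 (Algorithm 1, the forms `Q_i = α_i(V⃗_ext)`;
scanning over external dimensions) (`ChesterEtAl2020`).  R. E. Moore, *Methods and Applications of
Interval Analysis*, SIAM Studies in Applied Mathematics 2 (1979), §2.2 eqs. (2.14)–(2.15), (2.19)–(2.20)
(endpoint formulas of interval sum, difference and product), §2.4 (rounded interval arithmetic) (`Moore1979`).
F. Kos, D. Poland, D. Simmons-Duffin, *Bootstrapping
mixed correlators in the 3D Ising model*, JHEP 11 (2014) 109, §3.1 eq. (3.8) (`KosPolandSimmonsduffin2014`).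
-/

noncomputable section

open Set Matrix Finset

namespace Literature.MathematicalPhysics.QuantumFieldTheory.O2ExtFormEnclosure

open Literature.MathematicalPhysics.QuantumFieldTheory.ONVectorSumRule (Fm Fp)
open O2ThreeScalarCrossing O2ThreeScalarSystem O2OPEScanBridge OPESpaceCoverCertificate O2DimBox

/-! ### §1 Entries of `α(V⃗)` as node sums -/

/-- **Entries of `α(V⃗)` for a scan functional**: `α(V⃗)_{ik} = Σ_m Σ_r w_{m r} · V⃗_r(u_m, v_m)_{ik}`.
[cite: ChesterEtAl2020, §3.1 (functional conditions), §3.3 (`Q_i = α_i(V⃗_ext)`)] -/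
theorem alphaMat_toFunctional_apply (F : ScanFunctional) {n : ℕ}
    (V : ℝ → ℝ → Fin 22 → Matrix (Fin n) (Fin n) ℝ) (i k : Fin n) :
    alphaMat F.toFunctional V i k = ∑ m, ∑ r, F.w m r * V (F.u m) (F.v m) r i k := by
  simp only [alphaMat_apply, ScanFunctional.toFunctional, pointFunctional₂₂_apply]

/-! ### §2 Node tables give entry enclosures -/

/-- A real multiple of an enclosed number is enclosed by the two endpoint products (either sign of the
multiplier). [cite: Moore1979, §2.2 eq. (2.19) (interval product)] -/
theorem weightMul_mem_endpoints (w : ℝ) {x lo hi : ℝ} (hx : x ∈ Icc lo hi) :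
    min (w * lo) (w * hi) ≤ w * x ∧ w * x ≤ max (w * lo) (w * hi) := by
  rcases le_total 0 w with hw | hw
  · exact ⟨(min_le_left _ _).trans (mul_le_mul_of_nonneg_left hx.1 hw),
      (mul_le_mul_of_nonneg_left hx.2 hw).trans (le_max_right _ _)⟩
  · exact ⟨(min_le_right _ _).trans (mul_le_mul_of_nonpos_left hx.2 hw),
      (mul_le_mul_of_nonpos_left hx.1 hw).trans (le_max_left _ _)⟩

/-- **Lower enclosure matrix from node tables**: `(nodeEncLo)_{ik} = Σ_m Σ_r min (w_{mr} Lo_{mr,ik}) (w_{mr} Hi_{mr,ik})`.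
[cite: Moore1979, §2.2 eqs. (2.14), (2.19) (interval sum and product)] [cite: ChesterEtAl2020, §3.3 (`Q_i = α_i(V⃗_ext)`)] -/
def nodeEncLo (F : ScanFunctional) {n : ℕ} (Lo Hi : Fin F.M → Fin 22 → Matrix (Fin n) (Fin n) ℝ) :
    Matrix (Fin n) (Fin n) ℝ :=
  Matrix.of fun i k => ∑ m, ∑ r, min (F.w m r * Lo m r i k) (F.w m r * Hi m r i k)

/-- **Upper enclosure matrix from node tables**: `(nodeEncHi)_{ik} = Σ_m Σ_r max (w_{mr} Lo_{mr,ik}) (w_{mr} Hi_{mr,ik})`.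
[cite: Moore1979, §2.2 eqs. (2.14), (2.19) (interval sum and product)] [cite: ChesterEtAl2020, §3.3 (`Q_i = α_i(V⃗_ext)`)] -/
def nodeEncHi (F : ScanFunctional) {n : ℕ} (Lo Hi : Fin F.M → Fin 22 → Matrix (Fin n) (Fin n) ℝ) :
    Matrix (Fin n) (Fin n) ℝ :=
  Matrix.of fun i k => ∑ m, ∑ r, max (F.w m r * Lo m r i k) (F.w m r * Hi m r i k)

/-- **Node tables ⇒ entrywise enclosure of `α(V⃗)`.** [cite: Moore1979, §2.2 eqs. (2.14), (2.19) (interval sum and product)]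
[cite: ChesterEtAl2020, §3.3 (`Q_i = α_i(V⃗_ext)`)] -/
theorem alphaMat_toFunctional_inBounds (F : ScanFunctional) {n : ℕ}
    {V : ℝ → ℝ → Fin 22 → Matrix (Fin n) (Fin n) ℝ}
    {Lo Hi : Fin F.M → Fin 22 → Matrix (Fin n) (Fin n) ℝ}
    (hV : ∀ m r i k, V (F.u m) (F.v m) r i k ∈ Icc (Lo m r i k) (Hi m r i k)) :
    InBounds (alphaMat F.toFunctional V) (nodeEncLo F Lo Hi) (nodeEncHi F Lo Hi) := by
  intro i k
  rw [alphaMat_toFunctional_apply]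
  simp only [nodeEncLo, nodeEncHi, Matrix.of_apply]
  exact ⟨Finset.sum_le_sum fun m _ => Finset.sum_le_sum fun r _ => (weightMul_mem_endpoints _ (hV m r i k)).1,
    Finset.sum_le_sum fun m _ => Finset.sum_le_sum fun r _ => (weightMul_mem_endpoints _ (hV m r i k)).2⟩

/-! ### §3 Assembly of `α(V⃗_ext)` from the three channels -/

/-- **`α(V⃗_ext)` is the `extForm` of the three channel matrices** `α(V⃗_{0⁺,Δ_s,0}[g_s])` (`3 × 3`),
`α(V⃗_{1,Δ_φ,0}[g_φ])` (`ε = 1`, `2 × 2`), `α(V⃗_{2⁺,Δ_t,0}[g_t])` (`2 × 2`) — linearity of `α` over the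
index bookkeeping of `V⃗_ext`. [cite: ChesterEtAl2020, §3.2 (`V⃗_ext` defined implicitly)] -/
theorem alphaMat_Vext (α : (ℝ → ℝ → Fin 22 → ℝ) →ₗ[ℝ] ℝ) (D : Dims) (gs gφ gt : Label → ℝ → ℝ → ℝ) :
    alphaMat α (Vext D gs gφ gt) =
      extForm (alphaMat α (V0p D gs)) (alphaMat α (V1 D 1 gφ)) (alphaMat α (V2p D gt)) := by
  have hadd : ∀ f g : ℝ → ℝ → Fin 22 → ℝ,
      α (fun u v r => f u v r + g u v r) = α f + α g := fun f g => map_add α f g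
  have hzero : α (fun _ _ _ => (0 : ℝ)) = 0 := map_zero α
  ext i k
  fin_cases i <;> fin_cases k <;> simp [alphaMat, Vext, extForm, hadd, hzero]

/-- **`extForm` is entrywise monotone**: enclosures of the three blocks give an enclosure of the
assembled `4 × 4` matrix. [cite: ChesterEtAl2020, §3.2 (`V⃗_ext` defined implicitly)]
[cite: Moore1979, §2.2 eq. (2.14) (interval sum)] -/
theorem inBounds_extForm {M Mlo Mhi : Matrix (Fin 3) (Fin 3) ℝ}
    {P Plo Phi Q Qlo Qhi : Matrix (Fin 2) (Fin 2) ℝ}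
    (hM : InBounds M Mlo Mhi) (hP : InBounds P Plo Phi) (hQ : InBounds Q Qlo Qhi) :
    InBounds (extForm M P Q) (extForm Mlo Plo Qlo) (extForm Mhi Phi Qhi) := by
  intro i k
  fin_cases i <;> fin_cases k <;> simp [extForm]
  all_goals first
    | exact hM _ _
    | exact hP _ _
    | exact hQ _ _
    | exact ⟨add_le_add (hM _ _).1 (hP _ _).1, add_le_add (hM _ _).2 (hP _ _).2⟩
    | exact ⟨add_le_add (hM _ _).1 (hQ _ _).1, add_le_add (hM _ _).2 (hQ _ _).2⟩
    | exact ⟨add_le_add (hP _ _).1 (hQ _ _).1, add_le_add (hP _ _).2 (hQ _ _).2⟩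

/-- **Channel enclosures ⇒ `ExtEnclosed`.**  Entrywise enclosures of the three channel matrices, each valid
for EVERY genuine block family of its channel, enclose the external form of every genuine triple.
[cite: ChesterEtAl2020, §3.2 (`V⃗_ext`), §3.3 (`Q_i = α_i(V⃗_ext)`)] -/
theorem extEnclosed_of_channelBounds (α : (ℝ → ℝ → Fin 22 → ℝ) →ₗ[ℝ] ℝ) (D : Dims)
    {Mlo Mhi : Matrix (Fin 3) (Fin 3) ℝ} {Plo Phi Qlo Qhi : Matrix (Fin 2) (Fin 2) ℝ}
    (h0 : ∀ gs, GenuineOn D labels0p D.Δs 0 gs → InBounds (alphaMat α (V0p D gs)) Mlo Mhi)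
    (h1 : ∀ gφ, GenuineOn D labels1 D.Δφ 0 gφ → InBounds (alphaMat α (V1 D 1 gφ)) Plo Phi)
    (h2 : ∀ gt, GenuineOn D labels2p D.Δt 0 gt → InBounds (alphaMat α (V2p D gt)) Qlo Qhi) :
    ExtEnclosed α D (extForm Mlo Plo Qlo) (extForm Mhi Phi Qhi) := by
  intro gs gφ gt hs hφ ht
  rw [alphaMat_Vext]
  exact inBounds_extForm (h0 gs hs) (h1 gφ hφ) (h2 gt ht)

/-- **Outward rounding**: entrywise weaker bounds remain valid enclosures (the reader states rational
`Blo, Bhi`). [cite: Moore1979, §2.4 (rounded interval arithmetic: outward rounding)]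
[cite: ChesterEtAl2020, §3.3 (`Q_i = α_i(V⃗_ext)`)] -/
theorem extEnclosed_mono {α : (ℝ → ℝ → Fin 22 → ℝ) →ₗ[ℝ] ℝ} {D : Dims}
    {Blo Bhi Blo' Bhi' : Matrix (Fin 4) (Fin 4) ℝ} (h : ExtEnclosed α D Blo Bhi)
    (hlo : ∀ i k, Blo' i k ≤ Blo i k) (hhi : ∀ i k, Bhi i k ≤ Bhi' i k) : ExtEnclosed α D Blo' Bhi' :=
  fun gs gφ gt h1 h2 h3 i k =>
    ⟨(hlo i k).trans (h gs gφ gt h1 h2 h3 i k).1, (h gs gφ gt h1 h2 h3 i k).2.trans (hhi i k)⟩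

/-! ### §4 The reader's rule at one `D`: node tables of the three channels -/

/-- **Node table of a channel**: for every block family `g` genuine at `(Δ, 0)` on the labels `S`, every
component value `V⃗_r[g](u_m, v_m)_{ik}` of the channel's crossing vector at the nodes lies in
`[Lo_{m r ik}, Hi_{m r ik}]` (numbers a verifier certifies from block enclosures).
[cite: ChesterEtAl2020, §3.3 (`Q_i = α_i(V⃗_ext)`), App. «Crossing vectors»] -/
def NodeTable (F : ScanFunctional) (D : Dims) (S : List Label) (Δ : ℝ) {n : ℕ}
    (V : Dims → (Label → ℝ → ℝ → ℝ) → ℝ → ℝ → Fin 22 → Matrix (Fin n) (Fin n) ℝ)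
    (Lo Hi : Fin F.M → Fin 22 → Matrix (Fin n) (Fin n) ℝ) : Prop :=
  ∀ g : Label → ℝ → ℝ → ℝ, GenuineOn D S Δ 0 g →
    ∀ m r i k, V D g (F.u m) (F.v m) r i k ∈ Icc (Lo m r i k) (Hi m r i k)

/-- **Node tables of the three channels ⇒ `ExtEnclosed`** with the explicit bounds
`extForm (nodeEncLo …) (nodeEncLo …) (nodeEncLo …) ≤ α(V⃗_ext) ≤ extForm (nodeEncHi …) (nodeEncHi …) (nodeEncHi …)`.
[cite: ChesterEtAl2020, §3.2 (`V⃗_ext`), §3.3 (Algorithm 1: `Q_i = α_i(V⃗_ext)`)]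
[cite: Moore1979, §2.2 eqs. (2.14), (2.19) (interval sum and product)] -/
theorem extEnclosed_of_nodeTables (F : ScanFunctional) (D : Dims)
    {Lo0 Hi0 : Fin F.M → Fin 22 → Matrix (Fin 3) (Fin 3) ℝ}
    {Lo1 Hi1 Lo2 Hi2 : Fin F.M → Fin 22 → Matrix (Fin 2) (Fin 2) ℝ}
    (h0 : NodeTable F D labels0p D.Δs V0p Lo0 Hi0)
    (h1 : NodeTable F D labels1 D.Δφ (fun D' g => V1 D' 1 g) Lo1 Hi1)
    (h2 : NodeTable F D labels2p D.Δt V2p Lo2 Hi2) :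
    ExtEnclosed F.toFunctional D
      (extForm (nodeEncLo F Lo0 Hi0) (nodeEncLo F Lo1 Hi1) (nodeEncLo F Lo2 Hi2))
      (extForm (nodeEncHi F Lo0 Hi0) (nodeEncHi F Lo1 Hi1) (nodeEncHi F Lo2 Hi2)) :=
  extEnclosed_of_channelBounds F.toFunctional D
    (fun gs hs => alphaMat_toFunctional_inBounds F (h0 gs hs))
    (fun gφ hφ => alphaMat_toFunctional_inBounds F (h1 gφ hφ))
    (fun gt ht => alphaMat_toFunctional_inBounds F (h2 gt ht))

/-- **The reader's rule (C6) at one `D`**: node tables of the three channels and stated bounds `Blo, Bhi`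
entrywise outside the assembled enclosure give `ExtEnclosed F D Blo Bhi`.
[cite: ChesterEtAl2020, §3.3 (Algorithm 1: `Q_i = α_i(V⃗_ext)`)]
[cite: Moore1979, §2.4 (rounded interval arithmetic: outward rounding)] -/
theorem extEnclosed_of_nodeTables_of_le (F : ScanFunctional) (D : Dims)
    {Lo0 Hi0 : Fin F.M → Fin 22 → Matrix (Fin 3) (Fin 3) ℝ}
    {Lo1 Hi1 Lo2 Hi2 : Fin F.M → Fin 22 → Matrix (Fin 2) (Fin 2) ℝ} {Blo Bhi : Matrix (Fin 4) (Fin 4) ℝ}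
    (h0 : NodeTable F D labels0p D.Δs V0p Lo0 Hi0)
    (h1 : NodeTable F D labels1 D.Δφ (fun D' g => V1 D' 1 g) Lo1 Hi1)
    (h2 : NodeTable F D labels2p D.Δt V2p Lo2 Hi2)
    (hlo : ∀ i k, Blo i k ≤ extForm (nodeEncLo F Lo0 Hi0) (nodeEncLo F Lo1 Hi1) (nodeEncLo F Lo2 Hi2) i k)
    (hhi : ∀ i k, extForm (nodeEncHi F Lo0 Hi0) (nodeEncHi F Lo1 Hi1) (nodeEncHi F Lo2 Hi2) i k ≤ Bhi i k) :
    ExtEnclosed F.toFunctional D Blo Bhi :=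
  extEnclosed_mono (extEnclosed_of_nodeTables F D h0 h1 h2) hlo hhi

/-! ### §5 Component values from block values: enclosing `F_∓[g](u, v)` -/

/-- Product of an enclosed nonnegative factor with an enclosed number.
[cite: Moore1979, §2.2 eq. (2.19) (interval product)] -/
theorem powMul_mem_endpoints {y p₁ p₂ g a b : ℝ} (hy : y ∈ Icc p₁ p₂) (hp : 0 ≤ p₁)
    (hg : g ∈ Icc a b) : min (p₁ * a) (p₂ * a) ≤ y * g ∧ y * g ≤ max (p₁ * b) (p₂ * b) := by
  have hy0 : 0 ≤ y := hp.trans hy.1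
  constructor
  · refine le_trans ?_ (mul_le_mul_of_nonneg_left hg.1 hy0)
    rcases le_total 0 a with ha | ha
    · exact (min_le_left _ _).trans (mul_le_mul_of_nonneg_right hy.1 ha)
    · exact (min_le_right _ _).trans (mul_le_mul_of_nonpos_right hy.2 ha)
  · refine le_trans (mul_le_mul_of_nonneg_left hg.2 hy0) ?_
    rcases le_total 0 b with hb | hb
    · exact (mul_le_mul_of_nonneg_right hy.2 hb).trans (le_max_right _ _)
    · exact (mul_le_mul_of_nonpos_right hy.1 hb).trans (le_max_left _ _)

/-- **Enclosure of `F_−[g](u,v) = v^x g(u,v) − u^x g(v,u)`** from enclosures of the two block values and of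
the two powers. [cite: ChesterEtAl2020, §2.1 (`F^{ij,kl}_{∓,Δ,ℓ}`)]
[cite: Moore1979, §2.2 eqs. (2.14), (2.15), (2.19) (interval arithmetic)] -/
theorem Fm_mem_Icc {x u v a b a' b' p₁ p₂ q₁ q₂ : ℝ} {g : ℝ → ℝ → ℝ}
    (hg : g u v ∈ Icc a b) (hg' : g v u ∈ Icc a' b') (hv : v ^ x ∈ Icc p₁ p₂) (hu : u ^ x ∈ Icc q₁ q₂)
    (hp : 0 ≤ p₁) (hq : 0 ≤ q₁) :
    Fm x g u v ∈ Icc (min (p₁ * a) (p₂ * a) - max (q₁ * b') (q₂ * b'))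
      (max (p₁ * b) (p₂ * b) - min (q₁ * a') (q₂ * a')) := by
  have h1 := powMul_mem_endpoints hv hp hg
  have h2 := powMul_mem_endpoints hu hq hg'
  simp only [Fm, Set.mem_Icc]
  constructor <;> linarith [h1.1, h1.2, h2.1, h2.2]

/-- **Enclosure of `F_+[g](u,v) = v^x g(u,v) + u^x g(v,u)`.** [cite: ChesterEtAl2020, §2.1 (`F^{ij,kl}_{∓,Δ,ℓ}`)]
[cite: Moore1979, §2.2 eqs. (2.14), (2.15), (2.19) (interval arithmetic)] -/
theorem Fp_mem_Icc {x u v a b a' b' p₁ p₂ q₁ q₂ : ℝ} {g : ℝ → ℝ → ℝ}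
    (hg : g u v ∈ Icc a b) (hg' : g v u ∈ Icc a' b') (hv : v ^ x ∈ Icc p₁ p₂) (hu : u ^ x ∈ Icc q₁ q₂)
    (hp : 0 ≤ p₁) (hq : 0 ≤ q₁) :
    Fp x g u v ∈ Icc (min (p₁ * a) (p₂ * a) + min (q₁ * a') (q₂ * a'))
      (max (p₁ * b) (p₂ * b) + max (q₁ * b') (q₂ * b')) := by
  have h1 := powMul_mem_endpoints hv hp hg
  have h2 := powMul_mem_endpoints hu hq hg'
  simp only [Fp, Set.mem_Icc]
  constructor <;> linarith [h1.1, h1.2, h2.1, h2.2]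

/-- **Power enclosure on a box of exponents** (base in `(0, 1]`, e.g. a node's `u_m` or `v_m`; exponent
`x = (Δ_k+Δ_j)/2 ∈ [x₁, x₂]`, cf. `O2DimBox.expo_mem_Icc`): `t^x ∈ [t^{x₂}, t^{x₁}]`.
[cite: ChesterEtAl2020, §2.1 (exponents `(Δ_k+Δ_j)/2`), §3.3 (scanning over external dimensions)] -/
theorem rpow_mem_Icc_of_expo {t x x₁ x₂ : ℝ} (ht0 : 0 < t) (ht1 : t ≤ 1) (hx : x ∈ Icc x₁ x₂) :
    t ^ x ∈ Icc (t ^ x₂) (t ^ x₁) :=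
  ⟨Real.rpow_le_rpow_of_exponent_ge ht0 ht1 hx.2, Real.rpow_le_rpow_of_exponent_ge ht0 ht1 hx.1⟩

/-- The nodes' cross-ratio `u_m = z_m z̄_m` lies in `(0, 1)`. [cite: KosPolandSimmonsduffin2014, §3.1 eq. (3.8)] -/
theorem u_mem_Ioo (F : ScanFunctional) (m : Fin F.M) : F.u m ∈ Ioo (0 : ℝ) 1 := by
  obtain ⟨hz0, hz1⟩ := F.hz m
  obtain ⟨hb0, hb1⟩ := F.hzb m
  refine ⟨mul_pos hz0 hb0, ?_⟩
  calc F.z m * F.zb m < 1 * 1 := mul_lt_mul'' hz1 hb1 hz0.le hb0.le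
    _ = 1 := one_mul 1

/-- The nodes' cross-ratio `v_m = (1 − z_m)(1 − z̄_m)` lies in `(0, 1)`. [cite: KosPolandSimmonsduffin2014, §3.1 eq. (3.8)] -/
theorem v_mem_Ioo (F : ScanFunctional) (m : Fin F.M) : F.v m ∈ Ioo (0 : ℝ) 1 := by
  obtain ⟨hz0, hz1⟩ := F.hz m
  obtain ⟨hb0, hb1⟩ := F.hzb m
  refine ⟨mul_pos (by linarith) (by linarith), ?_⟩
  calc (1 - F.z m) * (1 - F.zb m) < 1 * 1 :=
      mul_lt_mul'' (by linarith) (by linarith) (by linarith) (by linarith)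
    _ = 1 := one_mul 1

/-! ### §5b The printed rows: every component is `c⁻ · F_−[g_L] + c⁺ · F_+[g_L]` of ONE label -/

/-- The label of row `r` of `V⃗_{0⁺}` (rows `0,2`: `φφφφ`; `3,5`: `tttt`; `8–11`: `ttφφ`; `12`: `ssss`;
`15,16`: `ttss`; `17,18`: `φφss`; zero rows: `φφφφ`). [cite: ChesterEtAl2020, App. «Crossing vectors» (`V⃗_{0⁺,Δ,ℓ⁺}`)] -/
def rowLab0p : Fin 22 → Label :=
  ![.φφφφ, .φφφφ, .φφφφ, .tttt, .φφφφ, .tttt, .φφφφ, .φφφφ, .ttφφ, .ttφφ, .ttφφ, .ttφφ, .ssss, .φφφφ,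
    .φφφφ, .ttss, .ttss, .φφss, .φφss, .φφφφ, .φφφφ, .φφφφ]

/-- Coefficient of `F_−` in row `r`, entry `(i,k)` of `V⃗_{0⁺}`.
[cite: ChesterEtAl2020, App. «Crossing vectors» (`V⃗_{0⁺,Δ,ℓ⁺}`)] -/
def coefM0p : Fin 22 → Matrix (Fin 3) (Fin 3) ℝ :=
  ![!![0, 0, 0; 0, 2, 0; 0, 0, 0], 0, 0, !![0, 0, 0; 0, 0, 0; 0, 0, 2], 0, 0, 0, 0,
    !![0, 0, 0; 0, 0, 1; 0, 1, 0], !![0, 0, 0; 0, 0, 1; 0, 1, 0], 0, 0,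
    !![2, 0, 0; 0, 0, 0; 0, 0, 0], 0, 0, !![0, 0, 1; 0, 0, 0; 1, 0, 0], 0,
    !![0, 1, 0; 1, 0, 0; 0, 0, 0], 0, 0, 0, 0]

/-- Coefficient of `F_+` in row `r`, entry `(i,k)` of `V⃗_{0⁺}`.
[cite: ChesterEtAl2020, App. «Crossing vectors» (`V⃗_{0⁺,Δ,ℓ⁺}`)] -/
def coefP0p : Fin 22 → Matrix (Fin 3) (Fin 3) ℝ :=
  ![0, 0, !![0, 0, 0; 0, -2, 0; 0, 0, 0], 0, 0, !![0, 0, 0; 0, 0, 0; 0, 0, -2], 0, 0, 0, 0,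
    !![0, 0, 0; 0, 0, -1; 0, -1, 0], !![0, 0, 0; 0, 0, -1; 0, -1, 0], 0, 0, 0, 0,
    !![0, 0, 1; 0, 0, 0; 1, 0, 0], 0, !![0, 1, 0; 1, 0, 0; 0, 0, 0], 0, 0, 0]

/-- **Rows of `V⃗_{0⁺}` decoded**: `V⃗_{0⁺,r}[g](u,v)_{ik} = c⁻_{r,ik} F_−[g_{L_r}](u,v) + c⁺_{r,ik} F_+[g_{L_r}](u,v)`.
[cite: ChesterEtAl2020, App. «Crossing vectors» (`V⃗_{0⁺,Δ,ℓ⁺}`)] -/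
theorem V0p_apply_eq (D : Dims) (g : Label → ℝ → ℝ → ℝ) (u v : ℝ) (r : Fin 22) (i k : Fin 3) :
    V0p D g u v r i k =
      coefM0p r i k * Fminus D g (rowLab0p r) u v + coefP0p r i k * Fplus D g (rowLab0p r) u v := by
  fin_cases r <;>
    simp only [V0p, coefM0p, coefP0p, rowLab0p, Matrix.cons_val_zero', Matrix.cons_val_succ'] <;>
    fin_cases i <;> fin_cases k <;> simp

/-- Every row label of `V⃗_{0⁺}` is one of `labels0p`. [cite: ChesterEtAl2020, App. «Crossing vectors» (`V⃗_{0⁺,Δ,ℓ⁺}`)] -/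
theorem rowLab0p_mem (r : Fin 22) : rowLab0p r ∈ labels0p := by
  fin_cases r <;> simp only [rowLab0p, Matrix.cons_val_zero', Matrix.cons_val_succ'] <;> simp [labels0p]

/-- The label of row `r` of `V⃗_1` (rows `6,7`: `tφtφ`; `9,11`: `φttφ`; `13`: `φsφs`; `17,18`: `sφφs`;
`19`: `φsφt`; `20,21`: `sφφt`; zero rows: `tφtφ`). [cite: ChesterEtAl2020, App. «Crossing vectors» (`V⃗_{1,Δ,ℓ}`)] -/
def rowLab1 : Fin 22 → Label :=
  ![.tφtφ, .tφtφ, .tφtφ, .tφtφ, .tφtφ, .tφtφ, .tφtφ, .tφtφ, .tφtφ, .φttφ, .tφtφ, .φttφ, .tφtφ, .φsφs,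
    .tφtφ, .tφtφ, .tφtφ, .sφφs, .sφφs, .φsφt, .sφφt, .sφφt]

/-- Coefficient of `F_−` in row `r`, entry `(i,k)` of `V⃗_{1,Δ,0}` (`ε = 1`).
[cite: ChesterEtAl2020, App. «Crossing vectors» (`V⃗_{1,Δ,ℓ}`)] -/
def coefM1 : Fin 22 → Matrix (Fin 2) (Fin 2) ℝ :=
  ![0, 0, 0, 0, 0, 0, !![0, 0; 0, 2], 0, 0, !![0, 0; 0, 2], 0, 0, 0, !![2, 0; 0, 0], 0, 0, 0,
    !![2, 0; 0, 0], 0, !![0, 1; 1, 0], !![0, 1; 1, 0], 0]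

/-- Coefficient of `F_+` in row `r`, entry `(i,k)` of `V⃗_{1,Δ,0}` (`ε = 1`).
[cite: ChesterEtAl2020, App. «Crossing vectors» (`V⃗_{1,Δ,ℓ}`)] -/
def coefP1 : Fin 22 → Matrix (Fin 2) (Fin 2) ℝ :=
  ![0, 0, 0, 0, 0, 0, 0, !![0, 0; 0, 2], 0, 0, 0, !![0, 0; 0, 2], 0, 0, 0, 0, 0, 0,
    !![-2, 0; 0, 0], 0, 0, !![0, 1; 1, 0]]

/-- **Rows of `V⃗_{1,Δ,0}` decoded** (`ε = 1`, the external `φ` has spin `0`).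
[cite: ChesterEtAl2020, App. «Crossing vectors» (`V⃗_{1,Δ,ℓ}`)] -/
theorem V1_one_apply_eq (D : Dims) (g : Label → ℝ → ℝ → ℝ) (u v : ℝ) (r : Fin 22) (i k : Fin 2) :
    V1 D 1 g u v r i k =
      coefM1 r i k * Fminus D g (rowLab1 r) u v + coefP1 r i k * Fplus D g (rowLab1 r) u v := by
  fin_cases r <;>
    simp only [V1, coefM1, coefP1, rowLab1, Matrix.cons_val_zero', Matrix.cons_val_succ'] <;>
    fin_cases i <;> fin_cases k <;> simp

/-- Every row label of `V⃗_1` is one of `labels1`. [cite: ChesterEtAl2020, App. «Crossing vectors» (`V⃗_{1,Δ,ℓ}`)] -/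
theorem rowLab1_mem (r : Fin 22) : rowLab1 r ∈ labels1 := by
  fin_cases r <;> simp only [rowLab1, Matrix.cons_val_zero', Matrix.cons_val_succ'] <;> simp [labels1]

/-- The label of row `r` of `V⃗_{2⁺}` (rows `1,2`: `φφφφ`; `14`: `tsts`; `15,16`: `stts`; `20,21`: `φφst`;
zero rows: `φφφφ`). [cite: ChesterEtAl2020, App. «Crossing vectors» (`V⃗_{2,Δ,ℓ⁺}`)] -/
def rowLab2p : Fin 22 → Label :=
  ![.φφφφ, .φφφφ, .φφφφ, .φφφφ, .φφφφ, .φφφφ, .φφφφ, .φφφφ, .φφφφ, .φφφφ, .φφφφ, .φφφφ, .φφφφ, .φφφφ,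
    .tsts, .stts, .stts, .φφφφ, .φφφφ, .φφφφ, .φφst, .φφst]

/-- Coefficient of `F_−` in row `r`, entry `(i,k)` of `V⃗_{2⁺}`.
[cite: ChesterEtAl2020, App. «Crossing vectors» (`V⃗_{2,Δ,ℓ⁺}`)] -/
def coefM2p : Fin 22 → Matrix (Fin 2) (Fin 2) ℝ :=
  ![0, !![2, 0; 0, 0], 0, 0, 0, 0, 0, 0, 0, 0, 0, 0, 0, 0, !![0, 0; 0, 2], !![0, 0; 0, 2], 0, 0, 0, 0,
    !![0, 1; 1, 0], 0]

/-- Coefficient of `F_+` in row `r`, entry `(i,k)` of `V⃗_{2⁺}`.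
[cite: ChesterEtAl2020, App. «Crossing vectors» (`V⃗_{2,Δ,ℓ⁺}`)] -/
def coefP2p : Fin 22 → Matrix (Fin 2) (Fin 2) ℝ :=
  ![0, 0, !![2, 0; 0, 0], 0, 0, 0, 0, 0, 0, 0, 0, 0, 0, 0, 0, 0, !![0, 0; 0, -2], 0, 0, 0, 0,
    !![0, -1; -1, 0]]

/-- **Rows of `V⃗_{2⁺}` decoded.** [cite: ChesterEtAl2020, App. «Crossing vectors» (`V⃗_{2,Δ,ℓ⁺}`)] -/
theorem V2p_apply_eq (D : Dims) (g : Label → ℝ → ℝ → ℝ) (u v : ℝ) (r : Fin 22) (i k : Fin 2) :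
    V2p D g u v r i k =
      coefM2p r i k * Fminus D g (rowLab2p r) u v + coefP2p r i k * Fplus D g (rowLab2p r) u v := by
  fin_cases r <;>
    simp only [V2p, coefM2p, coefP2p, rowLab2p, Matrix.cons_val_zero', Matrix.cons_val_succ'] <;>
    fin_cases i <;> fin_cases k <;> simp

/-- Every row label of `V⃗_{2⁺}` is one of `labels2p`. [cite: ChesterEtAl2020, App. «Crossing vectors» (`V⃗_{2,Δ,ℓ⁺}`)] -/
theorem rowLab2p_mem (r : Fin 22) : rowLab2p r ∈ labels2p := by
  fin_cases r <;> simp only [rowLab2p, Matrix.cons_val_zero', Matrix.cons_val_succ'] <;> simp [labels2p]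

/-- **`F`-tables of a channel**: for every block family genuine at `(Δ, 0)` on `S`, two-sided enclosures of
`F_−[g_L](u_m, v_m)` and `F_+[g_L](u_m, v_m)` for every `L ∈ S` and node `m` (what §5 produces from block-value
and power enclosures). [cite: ChesterEtAl2020, §2.1 (`F^{ij,kl}_{∓,Δ,ℓ}`), §3.3 (`Q_i = α_i(V⃗_ext)`)] -/
def FTable (F : ScanFunctional) (D : Dims) (S : List Label) (Δ : ℝ)
    (Am Bm Ap Bp : Fin F.M → Label → ℝ) : Prop :=
  ∀ g : Label → ℝ → ℝ → ℝ, GenuineOn D S Δ 0 g → ∀ m, ∀ L ∈ S,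
    Fminus D g L (F.u m) (F.v m) ∈ Icc (Am m L) (Bm m L) ∧ Fplus D g L (F.u m) (F.v m) ∈ Icc (Ap m L) (Bp m L)

/-- Lower node table assembled from an `F`-table through a row decoding `(c⁻, c⁺, L_r)`.
[cite: Moore1979, §2.2 eqs. (2.14), (2.19) (interval sum and product)] [cite: ChesterEtAl2020, App. «Crossing vectors»] -/
def compLo {M n : ℕ} (cM cP : Fin 22 → Matrix (Fin n) (Fin n) ℝ) (lab : Fin 22 → Label)
    (Am Bm Ap Bp : Fin M → Label → ℝ) : Fin M → Fin 22 → Matrix (Fin n) (Fin n) ℝ :=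
  fun m r => Matrix.of fun i k =>
    min (cM r i k * Am m (lab r)) (cM r i k * Bm m (lab r)) + min (cP r i k * Ap m (lab r)) (cP r i k * Bp m (lab r))

/-- Upper node table assembled from an `F`-table through a row decoding `(c⁻, c⁺, L_r)`.
[cite: Moore1979, §2.2 eqs. (2.14), (2.19) (interval sum and product)] [cite: ChesterEtAl2020, App. «Crossing vectors»] -/
def compHi {M n : ℕ} (cM cP : Fin 22 → Matrix (Fin n) (Fin n) ℝ) (lab : Fin 22 → Label)
    (Am Bm Ap Bp : Fin M → Label → ℝ) : Fin M → Fin 22 → Matrix (Fin n) (Fin n) ℝ :=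
  fun m r => Matrix.of fun i k =>
    max (cM r i k * Am m (lab r)) (cM r i k * Bm m (lab r)) + max (cP r i k * Ap m (lab r)) (cP r i k * Bp m (lab r))

/-- The decoding step: a component `c⁻ F_− + c⁺ F_+` with both `F`'s enclosed is enclosed by `compLo/compHi`.
[cite: Moore1979, §2.2 eqs. (2.14), (2.19) (interval sum and product)] -/
theorem decoded_mem_Icc {M n : ℕ} (cM cP : Fin 22 → Matrix (Fin n) (Fin n) ℝ) (lab : Fin 22 → Label)
    {Am Bm Ap Bp : Fin M → Label → ℝ} {m : Fin M} {r : Fin 22} {i k : Fin n} {fm fp : ℝ}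
    (hm : fm ∈ Icc (Am m (lab r)) (Bm m (lab r))) (hp : fp ∈ Icc (Ap m (lab r)) (Bp m (lab r))) :
    cM r i k * fm + cP r i k * fp ∈
      Icc (compLo cM cP lab Am Bm Ap Bp m r i k) (compHi cM cP lab Am Bm Ap Bp m r i k) := by
  have h1 := weightMul_mem_endpoints (cM r i k) hm
  have h2 := weightMul_mem_endpoints (cP r i k) hp
  simp only [compLo, compHi, Matrix.of_apply, Set.mem_Icc]
  exact ⟨add_le_add h1.1 h2.1, add_le_add h1.2 h2.2⟩

/-- **`F`-table of the `0⁺` channel ⇒ its node table.** [cite: ChesterEtAl2020, App. «Crossing vectors» (`V⃗_{0⁺,Δ,ℓ⁺}`), §3.3]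
[cite: Moore1979, §2.2 eqs. (2.14), (2.15), (2.19) (interval arithmetic)] -/
theorem nodeTable0p_of_FTable (F : ScanFunctional) (D : Dims) {Am Bm Ap Bp : Fin F.M → Label → ℝ}
    (h : FTable F D labels0p D.Δs Am Bm Ap Bp) :
    NodeTable F D labels0p D.Δs V0p (compLo coefM0p coefP0p rowLab0p Am Bm Ap Bp)
      (compHi coefM0p coefP0p rowLab0p Am Bm Ap Bp) := by
  intro g hg m r i k
  rw [V0p_apply_eq]
  obtain ⟨hm, hp⟩ := h g hg m (rowLab0p r) (rowLab0p_mem r)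
  exact decoded_mem_Icc coefM0p coefP0p rowLab0p hm hp

/-- **`F`-table of the charge-`1` channel ⇒ its node table** (`ε = 1`).
[cite: ChesterEtAl2020, App. «Crossing vectors» (`V⃗_{1,Δ,ℓ}`), §3.3]
[cite: Moore1979, §2.2 eqs. (2.14), (2.15), (2.19) (interval arithmetic)] -/
theorem nodeTable1_of_FTable (F : ScanFunctional) (D : Dims) {Am Bm Ap Bp : Fin F.M → Label → ℝ}
    (h : FTable F D labels1 D.Δφ Am Bm Ap Bp) :
    NodeTable F D labels1 D.Δφ (fun D' g => V1 D' 1 g) (compLo coefM1 coefP1 rowLab1 Am Bm Ap Bp)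
      (compHi coefM1 coefP1 rowLab1 Am Bm Ap Bp) := by
  intro g hg m r i k
  show V1 D 1 g (F.u m) (F.v m) r i k ∈ _
  rw [V1_one_apply_eq]
  obtain ⟨hm, hp⟩ := h g hg m (rowLab1 r) (rowLab1_mem r)
  exact decoded_mem_Icc coefM1 coefP1 rowLab1 hm hp

/-- **`F`-table of the `2⁺` channel ⇒ its node table.** [cite: ChesterEtAl2020, App. «Crossing vectors» (`V⃗_{2,Δ,ℓ⁺}`), §3.3]
[cite: Moore1979, §2.2 eqs. (2.14), (2.15), (2.19) (interval arithmetic)] -/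
theorem nodeTable2p_of_FTable (F : ScanFunctional) (D : Dims) {Am Bm Ap Bp : Fin F.M → Label → ℝ}
    (h : FTable F D labels2p D.Δt Am Bm Ap Bp) :
    NodeTable F D labels2p D.Δt V2p (compLo coefM2p coefP2p rowLab2p Am Bm Ap Bp)
      (compHi coefM2p coefP2p rowLab2p Am Bm Ap Bp) := by
  intro g hg m r i k
  rw [V2p_apply_eq]
  obtain ⟨hm, hp⟩ := h g hg m (rowLab2p r) (rowLab2p_mem r)
  exact decoded_mem_Icc coefM2p coefP2p rowLab2p hm hp

/-- **The reader's rule (C6) at one `D`, from `F`-tables**: three `F`-tables (one per external channel) and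
stated bounds `Blo, Bhi` entrywise outside the assembled enclosure give `ExtEnclosed F D Blo Bhi`.
[cite: ChesterEtAl2020, §3.2 (`V⃗_ext`), §3.3 (Algorithm 1: `Q_i = α_i(V⃗_ext)`)]
[cite: Moore1979, §2.2 eqs. (2.14), (2.15), (2.19) (interval arithmetic)] -/
theorem extEnclosed_of_FTables (F : ScanFunctional) (D : Dims)
    {Am0 Bm0 Ap0 Bp0 Am1 Bm1 Ap1 Bp1 Am2 Bm2 Ap2 Bp2 : Fin F.M → Label → ℝ} {Blo Bhi : Matrix (Fin 4) (Fin 4) ℝ}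
    (h0 : FTable F D labels0p D.Δs Am0 Bm0 Ap0 Bp0) (h1 : FTable F D labels1 D.Δφ Am1 Bm1 Ap1 Bp1)
    (h2 : FTable F D labels2p D.Δt Am2 Bm2 Ap2 Bp2)
    (hlo : ∀ i k, Blo i k ≤
      extForm (nodeEncLo F (compLo coefM0p coefP0p rowLab0p Am0 Bm0 Ap0 Bp0) (compHi coefM0p coefP0p rowLab0p Am0 Bm0 Ap0 Bp0))
        (nodeEncLo F (compLo coefM1 coefP1 rowLab1 Am1 Bm1 Ap1 Bp1) (compHi coefM1 coefP1 rowLab1 Am1 Bm1 Ap1 Bp1))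
        (nodeEncLo F (compLo coefM2p coefP2p rowLab2p Am2 Bm2 Ap2 Bp2) (compHi coefM2p coefP2p rowLab2p Am2 Bm2 Ap2 Bp2)) i k)
    (hhi : ∀ i k,
      extForm (nodeEncHi F (compLo coefM0p coefP0p rowLab0p Am0 Bm0 Ap0 Bp0) (compHi coefM0p coefP0p rowLab0p Am0 Bm0 Ap0 Bp0))
        (nodeEncHi F (compLo coefM1 coefP1 rowLab1 Am1 Bm1 Ap1 Bp1) (compHi coefM1 coefP1 rowLab1 Am1 Bm1 Ap1 Bp1))
        (nodeEncHi F (compLo coefM2p coefP2p rowLab2p Am2 Bm2 Ap2 Bp2) (compHi coefM2p coefP2p rowLab2p Am2 Bm2 Ap2 Bp2)) i k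
        ≤ Bhi i k) :
    ExtEnclosed F.toFunctional D Blo Bhi :=
  extEnclosed_of_nodeTables_of_le F D (nodeTable0p_of_FTable F D h0) (nodeTable1_of_FTable F D h1)
    (nodeTable2p_of_FTable F D h2) hlo hhi

/-! ### §6 Uniform on a box of external dimensions: the binder `henc` -/

/-- **The `henc` obligation of the uniform certificates, from node tables.**  For each functional `k`:
node tables of the three channels valid at EVERY `D` of its box `[lo k, hi k]`, and stated bounds
`Blo k, Bhi k` entrywise outside the assembled enclosure; then at every point of a region `Q` inside all
the boxes, every external form is enclosed — literally the hypothesis `henc` of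
`O2OPEScanBridge.boxExcluded_of_uniformCoverTrees` (and of the point / dimension-box schemas).
[cite: ChesterEtAl2020, §3.3 (Algorithm 1: `Q_i = α_i(V⃗_ext)`; scanning over external dimensions)]
[cite: Moore1979, §2.2 eqs. (2.14), (2.19), §2.4 (outward rounding)] -/
theorem henc_of_nodeTables {Q : Set (ℝ × ℝ × ℝ)} {ι : Type*} (F : ι → ScanFunctional)
    (lo hi : ι → Dims)
    (Lo0 Hi0 : ∀ k, Fin (F k).M → Fin 22 → Matrix (Fin 3) (Fin 3) ℝ)
    (Lo1 Hi1 Lo2 Hi2 : ∀ k, Fin (F k).M → Fin 22 → Matrix (Fin 2) (Fin 2) ℝ)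
    (Blo Bhi : ι → Matrix (Fin 4) (Fin 4) ℝ)
    (hQ : ∀ D : Dims, (D.Δs, D.Δφ, D.Δt) ∈ Q → ∀ k, InDimBox (lo k) (hi k) D)
    (h0 : ∀ k D, InDimBox (lo k) (hi k) D → NodeTable (F k) D labels0p D.Δs V0p (Lo0 k) (Hi0 k))
    (h1 : ∀ k D, InDimBox (lo k) (hi k) D →
      NodeTable (F k) D labels1 D.Δφ (fun D' g => V1 D' 1 g) (Lo1 k) (Hi1 k))
    (h2 : ∀ k D, InDimBox (lo k) (hi k) D → NodeTable (F k) D labels2p D.Δt V2p (Lo2 k) (Hi2 k))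
    (hlo : ∀ k i j, Blo k i j ≤
      extForm (nodeEncLo (F k) (Lo0 k) (Hi0 k)) (nodeEncLo (F k) (Lo1 k) (Hi1 k)) (nodeEncLo (F k) (Lo2 k) (Hi2 k)) i j)
    (hhi : ∀ k i j,
      extForm (nodeEncHi (F k) (Lo0 k) (Hi0 k)) (nodeEncHi (F k) (Lo1 k) (Hi1 k)) (nodeEncHi (F k) (Lo2 k) (Hi2 k)) i j
        ≤ Bhi k i j) :
    ∀ D : Dims, (D.Δs, D.Δφ, D.Δt) ∈ Q → ∀ k, ExtEnclosed (F k).toFunctional D (Blo k) (Bhi k) :=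
  fun D hD k =>
    extEnclosed_of_nodeTables_of_le (F k) D (h0 k D (hQ D hD k)) (h1 k D (hQ D hD k))
      (h2 k D (hQ D hD k)) (hlo k) (hhi k)

/-- **Box exclusion from node tables and certified trees** (over `boxExcluded_of_uniformCoverTrees`): ONE
functional list with the `l`-independent conditions on `Q`, node tables of the external channels valid on
each functional's box, stated enclosures outside the assembled ones, FOUR certified trees.
[cite: ChesterEtAl2020, §3.3 (Algorithm 1), §3.4] [cite: Moore1979, §2.2 eqs. (2.14), (2.15), (2.19) (interval arithmetic)] -/
theorem boxExcluded_of_nodeTables {A : O2Gaps} {Q : Set (ℝ × ℝ × ℝ)} {ι : Type*}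
    (F : ι → ScanFunctional) (lo hi : ι → Dims)
    (Lo0 Hi0 : ∀ k, Fin (F k).M → Fin 22 → Matrix (Fin 3) (Fin 3) ℝ)
    (Lo1 Hi1 Lo2 Hi2 : ∀ k, Fin (F k).M → Fin 22 → Matrix (Fin 2) (Fin 2) ℝ)
    (Blo Bhi : ι → Matrix (Fin 4) (Fin 4) ℝ) (T : Fin 4 → CoverTree ι 4)
    (hcore : ∀ D : Dims, (D.Δs, D.Δφ, D.Δt) ∈ Q → ∀ k, IsPositiveFor (F k).toFunctional A D 0)
    (hQ : ∀ D : Dims, (D.Δs, D.Δφ, D.Δt) ∈ Q → ∀ k, InDimBox (lo k) (hi k) D)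
    (h0 : ∀ k D, InDimBox (lo k) (hi k) D → NodeTable (F k) D labels0p D.Δs V0p (Lo0 k) (Hi0 k))
    (h1 : ∀ k D, InDimBox (lo k) (hi k) D →
      NodeTable (F k) D labels1 D.Δφ (fun D' g => V1 D' 1 g) (Lo1 k) (Hi1 k))
    (h2 : ∀ k D, InDimBox (lo k) (hi k) D → NodeTable (F k) D labels2p D.Δt V2p (Lo2 k) (Hi2 k))
    (hlo : ∀ k i j, Blo k i j ≤
      extForm (nodeEncLo (F k) (Lo0 k) (Hi0 k)) (nodeEncLo (F k) (Lo1 k) (Hi1 k)) (nodeEncLo (F k) (Lo2 k) (Hi2 k)) i j)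
    (hhi : ∀ k i j,
      extForm (nodeEncHi (F k) (Lo0 k) (Hi0 k)) (nodeEncHi (F k) (Lo1 k) (Hi1 k)) (nodeEncHi (F k) (Lo2 k) (Hi2 k)) i j
        ≤ Bhi k i j)
    (hT : ∀ i : Fin 4, (T i).Certifies (intervalVertexTest Blo Bhi) (facetLo i) (fun _ => (1 : ℝ))) :
    BoxExcluded A Q :=
  boxExcluded_of_uniformCoverTrees F Blo Bhi T hcore
    (henc_of_nodeTables F lo hi Lo0 Hi0 Lo1 Hi1 Lo2 Hi2 Blo Bhi hQ h0 h1 h2 hlo hhi) hT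

end Literature.MathematicalPhysics.QuantumFieldTheory.O2ExtFormEnclosure

end
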